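import Summits.Ventures.PercRepro.RankLevelSetExplicitArithB

/-!
# PercRepro — explicit thresholds at every level, the SPLIT count: the arithmetic (p9, S4)

The threshold `Tsplit q = 2^{2^{q−2}+q+5}·q² + q·2^{⌊2^q/q⌋+2q+1}` of THEOREM P′ (`proofs/SUBCLAIM-S4-p9.md`) and the
three-term polynomial inequality `poly_main_split`: with night-1's split fibre count
(`ncard_eRk_eq_ncard_le_le_split`, RankLevelSetDepCountSplit) the small-closure term carries
`σ_small ≤ 2^{2^{q−1}−1−q}` (the rank-`(q−1)` flat bound) and the big-closure term is independent of `n`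
(`C((q+1)d, ·)`), so the threshold's exponent is `2^{q−2}` in place of `2^{q−1}`. Also `bounds_of_two_pow_mul_sq_le`
(every regime threshold below any `T ≥ 2^{q+4}q²`), `N_term_bound'`, `choose_ge_of_big`
(`2^{2^q+2q²+1} ≤ C(p+q,q)` once `q·2^{⌊2^q/q⌋+2q+1} ≤ p+1`). Axioms: standard.
-/
namespace PercRepro

namespace ThmN

namespace Explicit

/-- The split threshold `Tsplit q = 2^{2^{q−2}+q+5}·q² + q·2^{⌊2^q/q⌋+2q+1}` of THEOREM P′. -/
def Tsplit (q : ℕ) : ℕ := 2 ^ (2 ^ (q - 2) + q + 5) * q ^ 2 + q * 2 ^ (2 ^ q / q + 2 * q + 1)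

/-- **(A0′)** every threshold of the core theorem is below any `T ≥ 2^{q+4}·q²` (`q ≥ 3`). -/
theorem bounds_of_two_pow_mul_sq_le (q T : ℕ) (hq : 3 ≤ q) (hT : 2 ^ (q + 4) * q ^ 2 ≤ T) :
    2 ^ (q + 1) + 2 * q ^ 2 + 4 * q + 4 ≤ T ∧ 2 ^ (q + 1) + 3 * q + 2 ≤ T ∧
      2 ^ q + 2 ≤ T ∧ 16 * q * 2 ^ q ≤ T ∧ 3 * (q + 2 ^ q) + 5 ≤ T := by
  have hx := succ_le_two_pow q
  rw [pow_add, show (2 : ℕ) ^ 4 = 16 by norm_num] at hT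
  have h4x : 4 ≤ 2 ^ q := by omega
  have h9 : 9 ≤ q ^ 2 := by nlinarith
  have hA : 16 * q * 2 ^ q ≤ 8 * (2 ^ q * q ^ 2) := by
    have : 2 * q ≤ q ^ 2 := by nlinarith
    calc 16 * q * 2 ^ q = 8 * 2 ^ q * (2 * q) := by ring
      _ ≤ 8 * 2 ^ q * q ^ 2 := Nat.mul_le_mul_left _ this
      _ = 8 * (2 ^ q * q ^ 2) := by ring
  have hB : 2 * q ^ 2 + 10 * q + 13 ≤ 4 * (2 ^ q * q ^ 2) := by
    have h1 : 16 * q ^ 2 ≤ 4 * (2 ^ q * q ^ 2) := by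
      calc 16 * q ^ 2 = 4 * (4 * q ^ 2) := by ring
        _ ≤ 4 * (2 ^ q * q ^ 2) := Nat.mul_le_mul_left _ (Nat.mul_le_mul_right _ h4x)
    have h2 : 2 * q ^ 2 + 10 * q + 13 ≤ 16 * q ^ 2 := by nlinarith
    omega
  have hC : 8 * 2 ^ q ≤ 4 * (2 ^ q * q ^ 2) := by
    calc 8 * 2 ^ q ≤ 2 ^ q * 36 := by omega
      _ = 4 * (2 ^ q * 9) := by ring
      _ ≤ 4 * (2 ^ q * q ^ 2) := Nat.mul_le_mul_left _ (Nat.mul_le_mul_left _ h9)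
  have hT' : 16 * (2 ^ q * q ^ 2) ≤ T := by
    calc 16 * (2 ^ q * q ^ 2) = 2 ^ q * 16 * q ^ 2 := by ring
      _ ≤ T := hT
  rw [pow_succ]
  refine ⟨?_, ?_, ?_, ?_, ?_⟩ <;> omega

/-- `2^{q+4}·q² ≤ Tsplit q` for `q ≥ 2`. -/
theorem two_pow_mul_sq_le_Tsplit (q : ℕ) : 2 ^ (q + 4) * q ^ 2 ≤ Tsplit q := by
  unfold Tsplit
  have h1 : 2 ^ (q + 4) ≤ 2 ^ (2 ^ (q - 2) + q + 5) :=
    Nat.pow_le_pow_right (by norm_num) (by linarith [Nat.zero_le (2 ^ (q - 2))])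
  calc 2 ^ (q + 4) * q ^ 2 ≤ 2 ^ (2 ^ (q - 2) + q + 5) * q ^ 2 := Nat.mul_le_mul_right _ h1
    _ ≤ _ := Nat.le_add_right _ _

/-- `(2^{2^{q−2}+q+5}·q²)² = 2^{2^{q−1}+2q+10}·q⁴` for `q ≥ 2`. -/
theorem Tsplit_first_sq (q : ℕ) (hq : 2 ≤ q) :
    (2 ^ (2 ^ (q - 2) + q + 5) * q ^ 2) ^ 2 = 2 ^ (2 ^ (q - 1) + 2 * q + 10) * q ^ 4 := by
  have h : 2 * 2 ^ (q - 2) = 2 ^ (q - 1) := by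
    rw [← pow_succ']; congr 1; omega
  have hexp : (2 ^ (q - 2) + q + 5) * 2 = 2 ^ (q - 1) + 2 * q + 10 := by rw [← h]; ring
  rw [mul_pow, ← pow_mul, ← pow_mul, hexp]

/-- `2^{2^{q−1}+2q+9} = 2^{2^{q−1}−1−q}·2^{3q+10}` for `q ≥ 3`. -/
theorem two_pow_split' (q : ℕ) (hq : 3 ≤ q) :
    2 ^ (2 ^ (q - 1) + 2 * q + 9) = 2 ^ (2 ^ (q - 1) - 1 - q) * 2 ^ (3 * q + 10) := by
  have h1 := succ_le_two_pow (q - 2)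
  have h2 : 2 * 2 ^ (q - 2) = 2 ^ (q - 1) := by
    rw [← pow_succ']; congr 1; omega
  have h3 : q + 1 ≤ 2 ^ (q - 1) := by omega
  rw [← pow_add]; congr 1; omega

/-- **(A5-iv, constant 1)** `16·(q'+2)(q'+1)²·2^{2(q'+2)+1} ≤ 2^{3(q'+2)+10}·(q'+2)⁴`. -/
theorem const_bound' (q' : ℕ) : 16 * ((q' + 2) * (q' + 1) ^ 2) * 2 ^ (2 * (q' + 2) + 1) ≤
    2 ^ (3 * (q' + 2) + 10) * (q' + 2) ^ 4 := by
  have e : 2 ^ (3 * (q' + 2) + 10) = 2 ^ (2 * (q' + 2) + 1) * 2 ^ (q' + 11) := by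
    rw [← pow_add]; congr 1; ring
  rw [e]
  have h16 : 16 ≤ 2 ^ (q' + 11) := by
    calc 16 = 2 ^ 4 := by norm_num
      _ ≤ 2 ^ (q' + 11) := Nat.pow_le_pow_right (by norm_num) (by omega)
  have hq1 : (q' + 1) ^ 2 ≤ (q' + 2) ^ 2 := Nat.pow_le_pow_left (by omega) 2
  have hy : (q' + 2) * (q' + 2) ^ 2 ≤ (q' + 2) ^ 4 := by
    calc (q' + 2) * (q' + 2) ^ 2 = (q' + 2) ^ 3 * 1 := by ring
      _ ≤ (q' + 2) ^ 3 * (q' + 2) := Nat.mul_le_mul_left _ (by omega)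
      _ = (q' + 2) ^ 4 := by ring
  calc 16 * ((q' + 2) * (q' + 1) ^ 2) * 2 ^ (2 * (q' + 2) + 1)
      ≤ 16 * ((q' + 2) * (q' + 2) ^ 2) * 2 ^ (2 * (q' + 2) + 1) :=
        Nat.mul_le_mul_right _ (Nat.mul_le_mul_left _ (Nat.mul_le_mul_left _ hq1))
    _ ≤ 2 ^ (q' + 11) * (q' + 2) ^ 4 * 2 ^ (2 * (q' + 2) + 1) :=
        Nat.mul_le_mul_right _ (Nat.mul_le_mul h16 hy)
    _ = 2 ^ (2 * (q' + 2) + 1) * 2 ^ (q' + 11) * (q' + 2) ^ 4 := by ring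

/-- **(A5-iv′, constant 1)** `8N ≤ 2^m·C` under the same hypotheses as `N_term_bound`. -/
theorem N_term_bound' (q' m p N σ₀ Cm Cn C : ℕ)
    (hN : N ≤ σ₀ * (q' + 1) * 2 ^ (2 * (q' + 2) + 1 + m) * Cm)
    (h5 : (p + 1) ^ 2 * Cm ≤ (q' + 2) * (q' + 1) * Cn) (h3 : Cn ≤ 2 * C)
    (hsq : σ₀ * 2 ^ (3 * (q' + 2) + 10) * (q' + 2) ^ 4 ≤ (p + 1) ^ 2) :
    8 * N ≤ 2 ^ m * C := by
  have hp2 : 0 < (p + 1) ^ 2 := by positivity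
  apply Nat.le_of_mul_le_mul_right _ hp2
  have hsplit : 2 ^ (2 * (q' + 2) + 1 + m) = 2 ^ (2 * (q' + 2) + 1) * 2 ^ m := pow_add _ _ _
  have hkey := const_bound' q'
  calc 8 * N * (p + 1) ^ 2
      ≤ 8 * (σ₀ * (q' + 1) * 2 ^ (2 * (q' + 2) + 1 + m) * Cm) * (p + 1) ^ 2 :=
        Nat.mul_le_mul_right _ (Nat.mul_le_mul_left _ hN)
    _ = 8 * σ₀ * (q' + 1) * 2 ^ (2 * (q' + 2) + 1 + m) * ((p + 1) ^ 2 * Cm) := by ring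
    _ ≤ 8 * σ₀ * (q' + 1) * 2 ^ (2 * (q' + 2) + 1 + m) * ((q' + 2) * (q' + 1) * Cn) :=
        Nat.mul_le_mul_left _ h5
    _ ≤ 8 * σ₀ * (q' + 1) * 2 ^ (2 * (q' + 2) + 1 + m) * ((q' + 2) * (q' + 1) * (2 * C)) :=
        Nat.mul_le_mul_left _ (Nat.mul_le_mul_left _ h3)
    _ = (16 * ((q' + 2) * (q' + 1) ^ 2) * 2 ^ (2 * (q' + 2) + 1)) * (σ₀ * 2 ^ m * C) := by
        rw [hsplit]; ring
    _ ≤ (2 ^ (3 * (q' + 2) + 10) * (q' + 2) ^ 4) * (σ₀ * 2 ^ m * C) := Nat.mul_le_mul_right _ hkey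
    _ = 2 ^ m * C * (σ₀ * 2 ^ (3 * (q' + 2) + 10) * (q' + 2) ^ 4) := by ring
    _ ≤ 2 ^ m * C * (p + 1) ^ 2 := Nat.mul_le_mul_left _ hsq

/-- `(p+1)^q ≤ q^q · C(p+q, q)` (the falling factorial and `q! ≤ q^q`). -/
theorem pow_le_pow_mul_choose (p q : ℕ) : (p + 1) ^ q ≤ q ^ q * (p + q).choose q := by
  have h1 : (p + q + 1 - q) ^ q ≤ (p + q).descFactorial q := Nat.pow_sub_le_descFactorial (p + q) q
  rw [Nat.descFactorial_eq_factorial_mul_choose, show p + q + 1 - q = p + 1 by omega] at h1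
  calc (p + 1) ^ q ≤ q.factorial * (p + q).choose q := h1
    _ ≤ q ^ q * (p + q).choose q := Nat.mul_le_mul_right _ (Nat.factorial_le_pow q)

/-- **(A6)** the big-closure term: `2^{2^q+2q²+1} ≤ C(p+q, q)` once `q·2^{⌊2^q/q⌋+2q+1} ≤ p + 1` (`q ≥ 1`). -/
theorem choose_ge_of_big (q p : ℕ) (hq : 1 ≤ q) (hp : q * 2 ^ (2 ^ q / q + 2 * q + 1) ≤ p + 1) :
    2 ^ (2 ^ q + 2 * q ^ 2 + 1) ≤ (p + q).choose q := by
  have hqq : 0 < q ^ q := by positivity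
  apply Nat.le_of_mul_le_mul_left _ hqq
  have hE : 2 ^ q + 2 * q ^ 2 + 1 ≤ (2 ^ q / q + 2 * q + 1) * q := by
    have hdm := Nat.div_add_mod (2 ^ q) q
    have hmod : 2 ^ q % q < q := Nat.mod_lt _ (by omega)
    nlinarith
  calc q ^ q * 2 ^ (2 ^ q + 2 * q ^ 2 + 1) ≤ q ^ q * 2 ^ ((2 ^ q / q + 2 * q + 1) * q) :=
        Nat.mul_le_mul_left _ (Nat.pow_le_pow_right (by norm_num) hE)
    _ = (q * 2 ^ (2 ^ q / q + 2 * q + 1)) ^ q := by rw [mul_pow, ← pow_mul]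
    _ ≤ (p + 1) ^ q := Nat.pow_le_pow_left hp q
    _ ≤ q ^ q * (p + q).choose q := pow_le_pow_mul_choose p q

/-- **(A5′) THE SPLIT POLYNOMIAL INEQUALITY** at every `(q, d)`, `d = q + 1 + m`, `m + 1 ≤ 2^q`, `p ≥ Tsplit q`:
`8·(C(p+d, q) + Ns + Nb) ≤ 7·2^{d−q}·C(p+q, q)` for the small-closure term
`Ns ≤ 2^{2^{q−1}−1−q}·(q−1)·2^{d+q}·C(p+d, q−2)` and the big-closure term
`Nb ≤ 2^{2^q−q−2}·(q−1)·2^{d+q}·((q+1)·d)^{q−2}`. -/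
theorem poly_main_split (q m p Ns Nb : ℕ) (hq : 3 ≤ q) (hm : m + 1 ≤ 2 ^ q) (hp : Tsplit q ≤ p)
    (hNs : Ns ≤ 2 ^ (2 ^ (q - 1) - 1 - q) * (q - 1) * 2 ^ (2 * q + 1 + m) * (p + q + 1 + m).choose (q - 2))
    (hNb : Nb ≤ 2 ^ (2 ^ q - q - 2) * (q - 1) * 2 ^ (2 * q + 1 + m) * ((q + 1) * (q + 1 + m)) ^ (q - 2)) :
    8 * ((p + q + 1 + m).choose q + (Ns + Nb)) ≤ 7 * 2 ^ (m + 1) * (p + q).choose q := by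
  obtain ⟨q', rfl⟩ : ∃ q', q = q' + 2 := ⟨q - 2, by omega⟩
  obtain ⟨-, -, -, h16, -⟩ := bounds_of_two_pow_mul_sq_le (q' + 2) p hq
    ((two_pow_mul_sq_le_Tsplit (q' + 2)).trans hp)
  have e1 : q' + 2 - 1 = q' + 1 := by omega
  have e2 : q' + 2 - 2 = q' := by omega
  rw [e1, e2] at hNs
  rw [e1, e2] at hNb
  have h16m : 8 * (2 * (q' + 2) * (m + 1)) ≤ p + 1 := by
    calc 8 * (2 * (q' + 2) * (m + 1)) ≤ 8 * (2 * (q' + 2) * 2 ^ (q' + 2)) :=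
          Nat.mul_le_mul_left _ (Nat.mul_le_mul_left _ hm)
      _ = 16 * (q' + 2) * 2 ^ (q' + 2) := by ring
      _ ≤ p + 1 := by omega
  obtain ⟨h2, h3⟩ := ratio_bounds (q' + 2) m p h16m
  have h5 := choose_two_down (p + (q' + 2) + 1 + m) q' p (by omega)
  -- the small term
  have hsq : 2 ^ (2 ^ (q' + 1) - 1 - (q' + 2)) * 2 ^ (3 * (q' + 2) + 10) * (q' + 2) ^ 4 ≤ (p + 1) ^ 2 := by
    have hT1 : 2 ^ (2 ^ (q' + 2 - 2) + (q' + 2) + 5) * (q' + 2) ^ 2 ≤ p + 1 := by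
      have := Nat.le_add_right (2 ^ (2 ^ (q' + 2 - 2) + (q' + 2) + 5) * (q' + 2) ^ 2)
        ((q' + 2) * 2 ^ (2 ^ (q' + 2) / (q' + 2) + 2 * (q' + 2) + 1))
      unfold Tsplit at hp
      omega
    have hT : (2 ^ (2 ^ (q' + 2 - 2) + (q' + 2) + 5) * (q' + 2) ^ 2) ^ 2 ≤ (p + 1) ^ 2 :=
      Nat.pow_le_pow_left hT1 2
    rw [Tsplit_first_sq (q' + 2) (by omega), show q' + 2 - 1 = q' + 1 by omega] at hT
    have h9 : 2 ^ (2 ^ (q' + 1) + 2 * (q' + 2) + 9) * (q' + 2) ^ 4 ≤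
        2 ^ (2 ^ (q' + 1) + 2 * (q' + 2) + 10) * (q' + 2) ^ 4 :=
      Nat.mul_le_mul_right _ (Nat.pow_le_pow_right (by norm_num) (by omega))
    have hs := two_pow_split' (q' + 2) (by omega)
    rw [show q' + 2 - 1 = q' + 1 by omega] at hs
    rw [← hs]
    exact h9.trans hT
  have h6 := N_term_bound' q' m p Ns _ _ _ _ hNs h5 h3 hsq
  -- the big term: `8·Nb ≤ 4·2^m·C`
  have hbig : 8 * Nb ≤ 4 * 2 ^ m * (p + (q' + 2)).choose (q' + 2) := by
    have hT2 : (q' + 2) * 2 ^ (2 ^ (q' + 2) / (q' + 2) + 2 * (q' + 2) + 1) ≤ p + 1 := by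
      have := Nat.le_add_left ((q' + 2) * 2 ^ (2 ^ (q' + 2) / (q' + 2) + 2 * (q' + 2) + 1))
        (2 ^ (2 ^ (q' + 2 - 2) + (q' + 2) + 5) * (q' + 2) ^ 2)
      unfold Tsplit at hp
      omega
    have hC := choose_ge_of_big (q' + 2) p (by omega) hT2
    have hqq : q' + 2 + 1 ≤ 2 ^ (q' + 2) := succ_le_two_pow (q' + 2)
    have hdd : q' + 2 + 1 + m ≤ 2 ^ (q' + 3) := by rw [pow_succ]; omega
    have hprod : ((q' + 2 + 1) * (q' + 2 + 1 + m)) ^ q' ≤ (2 ^ (2 * (q' + 2) + 1)) ^ q' := by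
      apply Nat.pow_le_pow_left
      calc (q' + 2 + 1) * (q' + 2 + 1 + m) ≤ 2 ^ (q' + 2) * 2 ^ (q' + 3) := Nat.mul_le_mul hqq hdd
        _ = 2 ^ (2 * (q' + 2) + 1) := by rw [← pow_add]; congr 1; ring
    have hq1 : q' + 1 ≤ 2 ^ (q' + 1) := by have := succ_le_two_pow (q' + 1); omega
    have hqe := succ_le_two_pow (q' + 2)
    -- `Nb ≤ 2^{S}` with `S = (2^q − q − 2) + (q−1) + (2q+1+m) + (2q+1)·q'`
    have hNb' : Nb ≤ 2 ^ ((2 ^ (q' + 2) - (q' + 2) - 2) + (q' + 1) + (2 * (q' + 2) + 1 + m) +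
        (2 * (q' + 2) + 1) * q') := by
      calc Nb ≤ 2 ^ (2 ^ (q' + 2) - (q' + 2) - 2) * (q' + 1) * 2 ^ (2 * (q' + 2) + 1 + m) *
            ((q' + 2 + 1) * (q' + 2 + 1 + m)) ^ q' := hNb
        _ ≤ 2 ^ (2 ^ (q' + 2) - (q' + 2) - 2) * 2 ^ (q' + 1) * 2 ^ (2 * (q' + 2) + 1 + m) *
            (2 ^ (2 * (q' + 2) + 1)) ^ q' := by gcongr
        _ = _ := by rw [← pow_mul, ← pow_add, ← pow_add, ← pow_add]
    have hexp : (2 ^ (q' + 2) - (q' + 2) - 2) + (q' + 1) + (2 * (q' + 2) + 1 + m) + (2 * (q' + 2) + 1) * q' + 3 ≤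
        m + (2 ^ (q' + 2) + 2 * (q' + 2) ^ 2 + 1) + 2 := by
      have e1 : (q' + 2) ^ 2 = q' * q' + 4 * q' + 4 := by ring
      have e2 : (2 * (q' + 2) + 1) * q' = 2 * (q' * q') + 5 * q' := by ring
      rw [e1, e2]
      omega
    calc 8 * Nb ≤ 8 * 2 ^ ((2 ^ (q' + 2) - (q' + 2) - 2) + (q' + 1) + (2 * (q' + 2) + 1 + m) +
          (2 * (q' + 2) + 1) * q') := Nat.mul_le_mul_left _ hNb'
      _ = 2 ^ ((2 ^ (q' + 2) - (q' + 2) - 2) + (q' + 1) + (2 * (q' + 2) + 1 + m) +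
          (2 * (q' + 2) + 1) * q' + 3) := by rw [pow_succ, pow_succ, pow_succ]; ring
      _ ≤ 2 ^ (m + (2 ^ (q' + 2) + 2 * (q' + 2) ^ 2 + 1) + 2) := Nat.pow_le_pow_right (by norm_num) hexp
      _ = 4 * 2 ^ m * 2 ^ (2 ^ (q' + 2) + 2 * (q' + 2) ^ 2 + 1) := by
          rw [pow_add, pow_add]; ring
      _ ≤ 4 * 2 ^ m * (p + (q' + 2)).choose (q' + 2) := Nat.mul_le_mul_left _ hC
  have h7 : 9 + (1 + 4) * 2 ^ m ≤ 7 * 2 ^ (m + 1) := by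
    have : 1 ≤ 2 ^ m := Nat.one_le_two_pow
    rw [pow_succ]; omega
  calc 8 * ((p + (q' + 2) + 1 + m).choose (q' + 2) + (Ns + Nb))
      = 8 * (p + (q' + 2) + 1 + m).choose (q' + 2) + 8 * Ns + 8 * Nb := by ring
    _ ≤ 9 * (p + (q' + 2)).choose (q' + 2) + 2 ^ m * (p + (q' + 2)).choose (q' + 2) +
        4 * 2 ^ m * (p + (q' + 2)).choose (q' + 2) := Nat.add_le_add (Nat.add_le_add h2 h6) hbig
    _ = (9 + (1 + 4) * 2 ^ m) * (p + (q' + 2)).choose (q' + 2) := by ring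
    _ ≤ 7 * 2 ^ (m + 1) * (p + (q' + 2)).choose (q' + 2) := Nat.mul_le_mul_right _ h7


end Explicit

end ThmN

end PercRepro
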